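import Mathlib.Analysis.SpecialFunctions.Sqrt
import Mathlib.Data.Matrix.Mul
import Mathlib.Order.Filter.Extr
import Mathlib.Tactic.Linarith
import Mathlib.Tactic.FieldSimp
import Mathlib.Tactic.Positivity
import HarnessLib

/-!
# Separable problems: decomposition of the dual function and the hanging chain (Luenberger–Ye, §13.3)

[LY08] = D. G. Luenberger, Y. Ye, *Linear and Nonlinear Programming* [LuenbergerYe2008], chapter
"Dual and Cutting Plane Methods" (Ch. 13 in the held copy `book:luenberger2008-linear-nonlinear-programming`;
Ch. 14 of the Springer 2008 printing), §13.3 "Separable problems": the separable problem (20)–(22),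
the paragraph "Decomposition" (the dual function of a separable problem is evaluated by `q` separate
minimisations), and Example 5 (the hanging chain) with its closed-form block minimiser (24) and dual
function (25).

Setting.  The variable is partitioned into blocks `x = (x_1, …, x_q)`, `x_i ∈ X_i`; the objective is
`Σ_i f_i(x_i)`, the constraints are `Σ_i h_i(x_i) = 0`, `Σ_i g_i(x_i) ≤ 0` ((20)–(22)).  The
Lagrangian `f(x) + λᵀh(x) + μᵀg(x)` is the sum over the blocks of the local Lagrangians
`f_i(x_i) + λᵀh_i(x_i) + μᵀg_i(x_i)` (`lagrangian_separates`), so that its minimisation over a product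
set `X_1 × ⋯ × X_q` splits into `q` independent minimisations (`isMinOn_pi_iff`: a point of the
product minimises the sum iff each block minimises its own term; `dual_decomposition` for the
Lagrangian itself).

Example 5 (hanging chain, `minimize Σ c_i y_i s.t. Σ y_i = 0, Σ √(1 − y_i²) = L`).  For one link the
local problem is `min_y (c_i + λ) y + μ √(1 − y²)` over `−1 ≤ y ≤ 1`; for `μ < 0` its minimiser is
(24) `y_i = −(c_i + λ)/√((c_i + λ)² + μ²)` with minimum value `−√((c_i + λ)² + μ²)`
(`chainTerm_ge`, `chainTerm_minimizer`, `isMinOn_chainTerm`; the first-order equation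
`c_i + λ − μ y_i/√(1 − y_i²) = 0` of the text is `chain_stationarity`), and summing gives the dual
function (25) `φ(λ, μ) = −Lμ − Σ_i √((c_i + λ)² + μ²)` as the minimum of the Lagrangian over the box
(`chainLagrangian_ge`, `chainLagrangian_minimizer`, `isMinOn_chainLagrangian`).

Nearest in-tree material: `Literature/Computation/Certificates/LagrangianSplitBound.lean` records the
two-block weak-duality split bound for linear objectives (Bertsekas, *Nonlinear Programming* §5.1.6);
the present file records the `q`-block minimiser characterisation of [LY08] §13.3 and its worked
hanging-chain dual (24)–(25) — no declaration is shared or restated.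

Published results only (Lean placement rule): every public declaration carries its
`[cite: LuenbergerYe2008, §13.3 …]` locator; the one generic helper is `private` and marked folklore.
-/

namespace Literature.Analysis.Convex.SeparableDualDecomposition

open Matrix Finset

/-! ### The separable Lagrangian and the decomposition principle -/

section Decomposition

variable {ι : Type*} [Fintype ι] {X : ι → Type*} {m p : Type*} [Fintype m] [Fintype p]

/-- [folklore] `uᵀ(Σ_i v_i) = Σ_i uᵀv_i`. -/
private theorem dot_sum (u : m → ℝ) (v : ι → m → ℝ) :
    u ⬝ᵥ (∑ i, v i) = ∑ i, u ⬝ᵥ v i := by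
  simp only [dotProduct, Finset.sum_apply, Finset.mul_sum]
  rw [Finset.sum_comm]

/-- The Lagrangian of the separable problem (20)–(22) written block by block:
`Σ_i [f_i(x_i) + λᵀh_i(x_i) + μᵀg_i(x_i)]`. [cite: LuenbergerYe2008, §13.3 Decomposition (display
defining φ(λ, μ))] -/
def sepLagrangian (f : (i : ι) → X i → ℝ) (h : (i : ι) → X i → (m → ℝ))
    (g : (i : ι) → X i → (p → ℝ)) (lam : m → ℝ) (mu : p → ℝ) (x : (i : ι) → X i) : ℝ :=
  ∑ i, (f i (x i) + lam ⬝ᵥ h i (x i) + mu ⬝ᵥ g i (x i))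

/-- **The Lagrangian separates.** `Σ_i f_i(x_i) + λᵀ(Σ_i h_i(x_i)) + μᵀ(Σ_i g_i(x_i))` equals the
sum of the local Lagrangians. [cite: LuenbergerYe2008, §13.3 Decomposition ("This minimization
problem decomposes into the q separate problems")] -/
theorem lagrangian_separates (f : (i : ι) → X i → ℝ) (h : (i : ι) → X i → (m → ℝ))
    (g : (i : ι) → X i → (p → ℝ)) (lam : m → ℝ) (mu : p → ℝ) (x : (i : ι) → X i) :
    (∑ i, f i (x i)) + lam ⬝ᵥ (∑ i, h i (x i)) + mu ⬝ᵥ (∑ i, g i (x i)) =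
      sepLagrangian f h g lam mu x := by
  unfold sepLagrangian
  rw [dot_sum, dot_sum, ← Finset.sum_add_distrib, ← Finset.sum_add_distrib]

/-- Block minimisers assemble into a minimiser of a separable sum over the product set.
[cite: LuenbergerYe2008, §13.3 Decomposition] -/
theorem isMinOn_pi_of_blocks (φ : (i : ι) → X i → ℝ) {S : (i : ι) → Set (X i)}
    {xs : (i : ι) → X i} (hmin : ∀ i, IsMinOn (φ i) (S i) (xs i)) :
    IsMinOn (fun x : (i : ι) → X i => ∑ i, φ i (x i)) (Set.pi Set.univ S) xs := by
  intro x hx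
  simp only [Set.mem_setOf_eq]
  exact Finset.sum_le_sum fun i _ => hmin i (Set.mem_univ_pi.mp hx i)

/-- Conversely, each block of a minimiser of a separable sum over a product set minimises its own
term. [cite: LuenbergerYe2008, §13.3 Decomposition] -/
theorem blocks_of_isMinOn_pi [DecidableEq ι] (φ : (i : ι) → X i → ℝ) {S : (i : ι) → Set (X i)}
    {xs : (i : ι) → X i} (hxs : xs ∈ Set.pi Set.univ S)
    (H : IsMinOn (fun x : (i : ι) → X i => ∑ i, φ i (x i)) (Set.pi Set.univ S) xs) (i : ι) :
    IsMinOn (φ i) (S i) (xs i) := by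
  intro y hy
  simp only [Set.mem_setOf_eq]
  set x' : (j : ι) → X j := Function.update xs i y with hx'
  have hx'mem : x' ∈ Set.pi Set.univ S := by
    refine Set.mem_univ_pi.mpr fun j => ?_
    by_cases hji : j = i
    · subst hji; simpa [hx'] using hy
    · simpa [hx', Function.update_of_ne hji] using Set.mem_univ_pi.mp hxs j
  have key := H hx'mem
  simp only [Set.mem_setOf_eq] at key
  rw [← Finset.add_sum_erase _ _ (Finset.mem_univ i),
    ← Finset.add_sum_erase _ (fun j => φ j (x' j)) (Finset.mem_univ i)] at key
  have hrest : ∑ j ∈ Finset.univ.erase i, φ j (x' j) = ∑ j ∈ Finset.univ.erase i, φ j (xs j) := by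
    refine Finset.sum_congr rfl fun j hj => ?_
    rw [hx', Function.update_of_ne (Finset.ne_of_mem_erase hj)]
  have hi : x' i = y := by simp [hx']
  rw [hrest, hi] at key
  linarith

/-- **Decomposition principle.** For a point of the product set `X_1 × ⋯ × X_q`, minimising the
separable sum is equivalent to minimising block by block. [cite: LuenbergerYe2008, §13.3
Decomposition] -/
theorem isMinOn_pi_iff [DecidableEq ι] (φ : (i : ι) → X i → ℝ) {S : (i : ι) → Set (X i)}
    {xs : (i : ι) → X i} (hxs : xs ∈ Set.pi Set.univ S) :
    IsMinOn (fun x : (i : ι) → X i => ∑ i, φ i (x i)) (Set.pi Set.univ S) xs ↔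
      ∀ i, IsMinOn (φ i) (S i) (xs i) :=
  ⟨fun H i => blocks_of_isMinOn_pi φ hxs H i, fun hmin => isMinOn_pi_of_blocks φ hmin⟩

/-- **Dual function of a separable problem.** Evaluating `φ(λ, μ) = min_x Σ_i [f_i(x_i) + λᵀh_i(x_i)
+ μᵀg_i(x_i)]` over `X_1 × ⋯ × X_q` reduces to the `q` separate problems
`min_{x_i ∈ X_i} f_i(x_i) + λᵀh_i(x_i) + μᵀg_i(x_i)`: a point of the product minimises the Lagrangian
iff each block solves its subproblem. [cite: LuenbergerYe2008, §13.3 Decomposition] -/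
theorem dual_decomposition [DecidableEq ι] (f : (i : ι) → X i → ℝ) (h : (i : ι) → X i → (m → ℝ))
    (g : (i : ι) → X i → (p → ℝ)) (lam : m → ℝ) (mu : p → ℝ) {S : (i : ι) → Set (X i)}
    {xs : (i : ι) → X i} (hxs : xs ∈ Set.pi Set.univ S) :
    IsMinOn (sepLagrangian f h g lam mu) (Set.pi Set.univ S) xs ↔
      ∀ i, IsMinOn (fun xi => f i xi + lam ⬝ᵥ h i xi + mu ⬝ᵥ g i xi) (S i) (xs i) :=
  isMinOn_pi_iff (fun i xi => f i xi + lam ⬝ᵥ h i xi + mu ⬝ᵥ g i xi) hxs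

end Decomposition

/-! ### Example 5: the hanging chain -/

section HangingChain

/-- One link's local Lagrangian in Example 5: `a·y + μ√(1 − y²)` with `a = c_i + λ`.
[cite: LuenbergerYe2008, §13.3 Example 5 (display defining φ(λ, μ))] -/
noncomputable def chainTerm (a μ y : ℝ) : ℝ := a * y + μ * Real.sqrt (1 - y ^ 2)

/-- The block minimiser (24): `y_i = −(c_i + λ)/[(c_i + λ)² + μ²]^{1/2}`.
[cite: LuenbergerYe2008, §13.3 Example 5 (24)] -/
noncomputable def chainMinimizer (a μ : ℝ) : ℝ := -a / Real.sqrt (a ^ 2 + μ ^ 2)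

/-- Lower bound for one link: `a·y + μ√(1 − y²) ≥ −√(a² + μ²)` on `−1 ≤ y ≤ 1` (Cauchy–Schwarz in
the plane, `y² + (√(1 − y²))² = 1`). [cite: LuenbergerYe2008, §13.3 Example 5 (24)–(25)] -/
theorem chainTerm_ge (a μ : ℝ) {y : ℝ} (hy1 : -1 ≤ y) (hy2 : y ≤ 1) :
    -Real.sqrt (a ^ 2 + μ ^ 2) ≤ chainTerm a μ y := by
  unfold chainTerm
  set s := Real.sqrt (1 - y ^ 2) with hs
  have hy : 0 ≤ 1 - y ^ 2 := by nlinarith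
  have hs2 : s ^ 2 = 1 - y ^ 2 := by rw [hs, Real.sq_sqrt hy]
  have hsq : (a * y + μ * s) ^ 2 ≤ a ^ 2 + μ ^ 2 := by nlinarith [sq_nonneg (a * s - μ * y)]
  have := Real.abs_le_sqrt hsq
  exact (abs_le.mp this).1

/-- For `μ < 0` the point (24) lies in `[−1, 1]`. [cite: LuenbergerYe2008, §13.3 Example 5 (24)] -/
theorem chainMinimizer_mem (a : ℝ) {μ : ℝ} (hμ : μ < 0) :
    -1 ≤ chainMinimizer a μ ∧ chainMinimizer a μ ≤ 1 := by
  unfold chainMinimizer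
  have hpos : 0 < a ^ 2 + μ ^ 2 := by nlinarith [sq_nonneg a]
  have hR : 0 < Real.sqrt (a ^ 2 + μ ^ 2) := Real.sqrt_pos.mpr hpos
  have hR2 : Real.sqrt (a ^ 2 + μ ^ 2) ^ 2 = a ^ 2 + μ ^ 2 := Real.sq_sqrt hpos.le
  have habs : |a| ≤ Real.sqrt (a ^ 2 + μ ^ 2) := Real.abs_le_sqrt (by nlinarith)
  rw [← abs_le, abs_div, abs_neg, abs_of_pos hR, div_le_one hR]
  exact habs

/-- At the point (24) the complementary length is `√(1 − y_i²) = −μ/√((c_i + λ)² + μ²)` (the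
"minus sign" of the text: `√(μ²) = −μ` for `μ < 0`). [cite: LuenbergerYe2008, §13.3 Example 5
(between (24) and (25))] -/
theorem sqrt_one_sub_chainMinimizer_sq (a : ℝ) {μ : ℝ} (hμ : μ < 0) :
    Real.sqrt (1 - chainMinimizer a μ ^ 2) = -μ / Real.sqrt (a ^ 2 + μ ^ 2) := by
  unfold chainMinimizer
  have hpos : 0 < a ^ 2 + μ ^ 2 := by nlinarith [sq_nonneg a]
  have hR : 0 < Real.sqrt (a ^ 2 + μ ^ 2) := Real.sqrt_pos.mpr hpos
  have hR2 : Real.sqrt (a ^ 2 + μ ^ 2) ^ 2 = a ^ 2 + μ ^ 2 := Real.sq_sqrt hpos.le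
  have h1 : 1 - (-a / Real.sqrt (a ^ 2 + μ ^ 2)) ^ 2 = (-μ / Real.sqrt (a ^ 2 + μ ^ 2)) ^ 2 := by
    field_simp
    nlinarith [hR2]
  rw [h1, Real.sqrt_sq (div_nonneg (by linarith) hR.le)]

/-- **(24) attains the bound.** For `μ < 0`, `a·y_i + μ√(1 − y_i²) = −√(a² + μ²)` at the point
(24). [cite: LuenbergerYe2008, §13.3 Example 5 (24)–(25)] -/
theorem chainTerm_minimizer (a : ℝ) {μ : ℝ} (hμ : μ < 0) :
    chainTerm a μ (chainMinimizer a μ) = -Real.sqrt (a ^ 2 + μ ^ 2) := by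
  unfold chainTerm
  rw [sqrt_one_sub_chainMinimizer_sq a hμ]
  unfold chainMinimizer
  have hpos : 0 < a ^ 2 + μ ^ 2 := by nlinarith [sq_nonneg a]
  have hR : 0 < Real.sqrt (a ^ 2 + μ ^ 2) := Real.sqrt_pos.mpr hpos
  have hR2 : Real.sqrt (a ^ 2 + μ ^ 2) ^ 2 = a ^ 2 + μ ^ 2 := Real.sq_sqrt hpos.le
  field_simp
  nlinarith [hR2]

/-- **Example 5, block problem solved.** For `μ < 0` the point (24) minimises
`(c_i + λ)y + μ√(1 − y²)` over `−1 ≤ y ≤ 1` ("The above represents a local minimum point provided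
μ < 0"). [cite: LuenbergerYe2008, §13.3 Example 5 (24)] -/
theorem isMinOn_chainTerm (a : ℝ) {μ : ℝ} (hμ : μ < 0) :
    IsMinOn (chainTerm a μ) (Set.Icc (-1) 1) (chainMinimizer a μ) := by
  intro y hy
  simp only [Set.mem_setOf_eq]
  rw [chainTerm_minimizer a hμ]
  exact chainTerm_ge a μ hy.1 hy.2

/-- The first-order equation of the text, `c_i + λ − μ y_i/√(1 − y_i²) = 0`, holds at (24).
[cite: LuenbergerYe2008, §13.3 Example 5 (equation before (24))] -/
theorem chain_stationarity (a : ℝ) {μ : ℝ} (hμ : μ < 0) :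
    a - μ * chainMinimizer a μ / Real.sqrt (1 - chainMinimizer a μ ^ 2) = 0 := by
  rw [sqrt_one_sub_chainMinimizer_sq a hμ]
  unfold chainMinimizer
  have hpos : 0 < a ^ 2 + μ ^ 2 := by nlinarith [sq_nonneg a]
  have hR : 0 < Real.sqrt (a ^ 2 + μ ^ 2) := Real.sqrt_pos.mpr hpos
  have hμ0 : μ ≠ 0 := hμ.ne
  field_simp
  ring

variable {ι : Type*} [Fintype ι]

/-- The Lagrangian of the chain problem for fixed multipliers:
`Σ_i {c_i y_i + λ y_i + μ√(1 − y_i²)} − Lμ`. [cite: LuenbergerYe2008, §13.3 Example 5 (display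
defining φ(λ, μ))] -/
noncomputable def chainLagrangian (c : ι → ℝ) (L lam μ : ℝ) (y : ι → ℝ) : ℝ :=
  ∑ i, (c i * y i + lam * y i + μ * Real.sqrt (1 - y i ^ 2)) - L * μ

/-- The dual function (25): `φ(λ, μ) = −Lμ − Σ_i √((c_i + λ)² + μ²)`.
[cite: LuenbergerYe2008, §13.3 Example 5 (25)] -/
noncomputable def chainDual (c : ι → ℝ) (L lam μ : ℝ) : ℝ :=
  -L * μ - ∑ i, Real.sqrt ((c i + lam) ^ 2 + μ ^ 2)

omit [Fintype ι] in
/-- Each summand of the chain Lagrangian is the local term with `a = c_i + λ`.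
[cite: LuenbergerYe2008, §13.3 Example 5] -/
theorem chain_summand_eq (c : ι → ℝ) (lam μ : ℝ) (y : ι → ℝ) (i : ι) :
    c i * y i + lam * y i + μ * Real.sqrt (1 - y i ^ 2) = chainTerm (c i + lam) μ (y i) := by
  unfold chainTerm
  ring

/-- (25) bounds the Lagrangian from below on the box `−1 ≤ y_i ≤ 1`.
[cite: LuenbergerYe2008, §13.3 Example 5 (25)] -/
theorem chainLagrangian_ge (c : ι → ℝ) (L lam μ : ℝ) {y : ι → ℝ}
    (hy : ∀ i, -1 ≤ y i ∧ y i ≤ 1) : chainDual c L lam μ ≤ chainLagrangian c L lam μ y := by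
  unfold chainDual chainLagrangian
  have : -∑ i, Real.sqrt ((c i + lam) ^ 2 + μ ^ 2) ≤
      ∑ i, (c i * y i + lam * y i + μ * Real.sqrt (1 - y i ^ 2)) := by
    rw [← Finset.sum_neg_distrib]
    refine Finset.sum_le_sum fun i _ => ?_
    rw [chain_summand_eq]
    exact chainTerm_ge (c i + lam) μ (hy i).1 (hy i).2
  linarith

/-- **(25) is attained at (24).** For `μ < 0`, plugging the block minimisers (24) into the Lagrangian
gives `−Lμ − Σ_i √((c_i + λ)² + μ²)`. [cite: LuenbergerYe2008, §13.3 Example 5 (24)–(25)] -/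
theorem chainLagrangian_minimizer (c : ι → ℝ) (L lam : ℝ) {μ : ℝ} (hμ : μ < 0) :
    chainLagrangian c L lam μ (fun i => chainMinimizer (c i + lam) μ) = chainDual c L lam μ := by
  unfold chainLagrangian chainDual
  have : ∑ i, (c i * chainMinimizer (c i + lam) μ + lam * chainMinimizer (c i + lam) μ +
      μ * Real.sqrt (1 - chainMinimizer (c i + lam) μ ^ 2)) =
      -∑ i, Real.sqrt ((c i + lam) ^ 2 + μ ^ 2) := by
    rw [← Finset.sum_neg_distrib]
    refine Finset.sum_congr rfl fun i _ => ?_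
    rw [chain_summand_eq (y := fun i => chainMinimizer (c i + lam) μ), chainTerm_minimizer _ hμ]
  rw [this]
  ring

/-- **Example 5, dual function.** For `μ < 0` the dual function value — the minimum of the
Lagrangian over the box `−1 ≤ y_i ≤ 1` — is (25), attained at the separable minimiser (24).
[cite: LuenbergerYe2008, §13.3 Example 5 (24)–(25)] -/
theorem isMinOn_chainLagrangian (c : ι → ℝ) (L lam : ℝ) {μ : ℝ} (hμ : μ < 0) :
    IsMinOn (chainLagrangian c L lam μ) {y | ∀ i, -1 ≤ y i ∧ y i ≤ 1}
      (fun i => chainMinimizer (c i + lam) μ) := by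
  intro y hy
  simp only [Set.mem_setOf_eq]
  rw [chainLagrangian_minimizer c L lam hμ]
  exact chainLagrangian_ge c L lam μ hy

end HangingChain

end Literature.Analysis.Convex.SeparableDualDecomposition
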